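import Summits.HodgeConjecture.HodgeConjecture.Theorems.MarkmanPartnerTransportSqrtTwoPartnerDescent
import Summits.HodgeConjecture.HodgeConjecture.Theorems.MarkmanPartnerTransportPartnerTransport
import Summits.HodgeConjecture.HodgeConjecture.Theorems.MarkmanPartnerTransportPartnerPicardRank
import Summits.HodgeConjecture.HodgeConjecture.Theorems.MarkmanPartnerTransportPartnerExistenceOfPeriodSurjective
import Summits.HodgeConjecture.HodgeConjecture.Theorems.MarkmanPartnerTransportPicardThreeK3SquaresRealMultiplicationTypeCorollaries

/-!
# Route MarkmanPartnerTransport · target `K3Sq2TypeHodge` ∕ crux #4 `PicardThreeK3Squares` (stmt-HodgeConjecture-19652) —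
# «RANK-PARTNERED-HK»: the Hodge conjecture for marked `K3^{[2]}`-type fourfolds of Picard number `9, 13, 15, 17`,
# modulo the quadratic Noether–Lefschetz ascent, the Picard-number-2 quadratic cell, and named facts

The fourfold-side reading of `RealMultiplicationType.hodgeConjectureFor_square_of_rank_mem` (p719322: HC⁴(`S ⊗ S`) for EVERY
projective K3 surface with `ρ(S) ∈ {8, 12, 14, 16}`, granted Buskin, markings, the displayed QUADRATIC ascent families of
`…NLAscentQuadratic` and HC⁴ for the non-CM quadratic-RM K3 squares of Picard number `2`). A K3 partner `(S, η, p, x, g)` of a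
marked `K3^{[2]}`-type `X` has `ρ(S) = ρ(X) − 1` EXACTLY (`finrank_algebraicClasses_le_partner_succ_of_partner` from (g1),
(g2), (g5) through Beauville's marked Hilbert square, and `finrank_algebraicClasses_succ_le_of_partner_onto` from the onto clause
(g6)), and `PartnerTransport` carries HC⁴(`S ⊗ S`) to HC⁴(`X`) (`partnerTransport_explicit`). Hence:

* `hodgeConjectureFor_of_partner_of_rank_mem` — POINTWISE: marked smooth projective `K3^{[2]}`-type `X` with
  `ρ(X) ∈ {9, 13, 15, 17}` and a K3 partner with (g1), (g2), (g5), (g6) ⟹ `HodgeConjectureFor 4 X`;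
* `hodgeConjectureFor_of_rank_mem_K3Sq2Type` — **for EVERY marked smooth projective `K3^{[2]}`-type fourfold with
  `ρ(X) ∈ {9, 13, 15, 17}`**: the partner exists (`partnerExistence_explicit`, period surjectivity).

CONDITIONAL on the displayed named facts {`Beauville1983_hilbertSquare_markedIncidence`,
`Beauville1983_hilbertSquare_blowupDiagonal_surjection`, `Markman2024_rationalHodgeIsometry_lift_algebraic_marked`,
`Voisin2003_cupProduct_algebraicClasses`, `Buskin2019_hodgeIsometry_algebraic`, `Huybrechts_K3_marking_exists`,
`Huybrechts_K3_periodSurjective_projective` (second form)} AND on the two displayed open inputs of `…NLAscentQuadratic`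
(the quadratic ascent families = moduli input (I1′); HC⁴ for the Picard-number-2 quadratic-RM K3 squares = crux #5's cell
`(3,2)` in K3 form). Pure assembly; no definition, no sorry, no new named fact; credits nothing to HC. Prover seat
hodge-nonav-19652-p1 (gen 19), `--supports stmt-HodgeConjecture-19652`.

References: E. Markman, Compos. Math. 160 (2024) Thm. 1.1, 1.4; A. Beauville, J. Differential Geom. 18 (1983) §6 Prop. 6;
D. Huybrechts, *Lectures on K3 Surfaces* Ch. 3 Lemma 3.1, Ch. 6 Thm. 3.1, Ch. 7 Thm. 4.1; B. van Geemen, M. Schütt,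
Forum Math. Sigma 13 (2025) e2 §2.6, Prop. 3.2, §6.6; N. Buskin, J. reine angew. Math. 755 (2019) Thm. 1.1.
-/

noncomputable section

set_option linter.dupNamespace false

open scoped Matrix
open Module CategoryTheory MonoidalCategory CartesianMonoidalCategory AlgebraicGeometry Polynomial
open Literature.AlgebraicTopology.SingularHomology Literature.Geometry.Kaehler
open Literature.AlgebraicGeometry Literature.AlgebraicGeometry.Motives Literature.AlgebraicGeometry.HodgeTheory
open Literature.AlgebraicGeometry.Hyperkaehler Literature.AlgebraicGeometry.Surfaces
open Literature.AlgebraicGeometry.HilbertScheme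
open Summit.HodgeConjecture.HodgeConjecture.Theorems.NikulinTwinTransport
open Summit.HodgeConjecture.HodgeConjecture.Theorems.MarkmanPartnerTransport.BBFPositivity

namespace Summit.HodgeConjecture.HodgeConjecture.Theorems.MarkmanPartnerTransport.PartnerLattice

/-- `MarkedK3Sq[X, φ, P, z]`: VERBATIM the `let MarkedK3Sq := …` binder of the route declarations of
MarkmanPartnerTransport (clauses (m1)–(m6)). Local notation only. -/
local notation3 (prettyPrint := false) "MarkedK3Sq[" X ", " φ ", " P ", " z "]" =>
  (((IsIntegralClass P ∧ ∀ Q : complexBetti X (2 * 4), IsIntegralClass Q → ∃ n : ℤ, Q = n • P) ∧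
    (∀ c : complexBetti X 2, IsIntegralClass c ↔ ∃ v : K3HilbertIndex → ℤ, φ c = fun i => (v i : ℂ)) ∧
    (∀ a : complexBetti X 2, cupPowTwo a 4 = ((3 : ℂ) * (k3HilbertForm 2 (φ a) (φ a)) ^ 2) • P) ∧
    (IsOfHodgeType 4 X 2 2 0 (LinearEquiv.symm φ z) ∧
      ∀ τ : complexBetti X 2, IsOfHodgeType 4 X 2 2 0 τ → ∃ t : ℂ, τ = t • LinearEquiv.symm φ z) ∧
    (∀ c : complexBetti X 2, IsOfHodgeType 4 X 2 1 1 c ↔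
      (k3HilbertForm 2 (φ c) z = 0 ∧ k3HilbertForm 2 (φ c) (star z) = 0)) ∧
    (k3HilbertForm 2 z z = 0 ∧ 0 < (k3HilbertForm 2 (star z) z).re)))

/-- `MarkedK3[S, η, p, x]`: VERBATIM the `let MarkedK3 := …` binder of the route declarations. Local notation only. -/
local notation3 (prettyPrint := false) "MarkedK3[" S ", " η ", " p ", " x "]" =>
  (p ≠ 0 ∧ (IsIntegralClass p ∧
    (∀ q : complexBetti S (2 * 2), IsIntegralClass q → ∃ n : ℤ, q = n • p) ∧
    (∀ c : complexBetti S (2 * 1), IsIntegralClass c ↔ ∃ v : K3Index → ℤ, η c = fun i => (v i : ℂ)) ∧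
    (∀ a b : complexBetti S (2 * 1),
      cupProduct (rfl : 2 * 1 + 2 * 1 = 2 * 2) a b = k3Form (η a) (η b) • p) ∧
    IsOfHodgeType 2 S (2 * 1) 2 0 (LinearEquiv.symm η x) ∧
    (∀ τ : complexBetti S (2 * 1), IsOfHodgeType 2 S (2 * 1) 2 0 τ →
      ∃ t : ℂ, τ = t • LinearEquiv.symm η x)) ∧
    (k3Form x x = 0 ∧ 0 < (k3Form (star x) x).re ∧
      ∃ u : K3Index → ℤ, k3Form (fun i => (u i : ℂ)) x = 0 ∧ 0 < ∑ i, ∑ j, u i * k3Gram i j * u j))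

/-- `Partner[X, φ, S, η, g]`: clauses (g1), (g2), (g5) of the route's `IsK3Partner` datum. Local notation only. -/
local notation3 (prettyPrint := false) "Partner[" X ", " φ ", " S ", " η ", " g "]" =>
  ((∀ a, IsRationalClass a → IsRationalClass (g a)) ∧
    (∀ (i j : ℕ) a, IsOfHodgeType 2 S (2 * 1) i j a → IsOfHodgeType 4 X 2 i j (g a)) ∧
    (∀ a b, (∀ d ∈ algebraicClasses S 1, cupProduct (rfl : 2 * 1 + 2 * 1 = 2 * 2) a d = 0) →
      (∀ d ∈ algebraicClasses S 1, cupProduct (rfl : 2 * 1 + 2 * 1 = 2 * 2) b d = 0) →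
      k3HilbertForm 2 (φ (g a)) (φ (g b)) = k3Form (η a) (η b)))

/-- `Onto[X, φ, S, g]`: clause (g6) of the route's `IsK3Partner` datum — `g` maps the cup-transcendental classes of `S`
ONTO the `q`-transcendental classes of `X`. Local notation only. -/
local notation3 (prettyPrint := false) "Onto[" X ", " φ ", " S ", " g "]" =>
  (∀ y : complexBetti X 2,
    (∀ d : complexBetti X 2, d ∈ algebraicClasses X 1 → k3HilbertForm 2 (φ y) (φ d) = 0) →
      ∃ a : complexBetti S (2 * 1),
        (∀ d ∈ algebraicClasses S 1, cupProduct (rfl : 2 * 1 + 2 * 1 = 2 * 2) a d = 0) ∧ g a = y)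

/-- `Corr[μ, hS ; γ, y] = fst_*(snd^* y ∪ γ)` on `H²(S(ℂ); ℂ)`. Local notation only. -/
local notation3 (prettyPrint := false) "Corr[" μ ", " hS " ; " γ ", " y "]" =>
  complexGysin μ (IsSmoothProjective.tensor_holds hS hS) hS
    (SemiCartesianMonoidalCategory.fst _ _) (rfl : 2 * 1 + 2 * 2 + 2 * 2 = 2 * 1 + 2 * (2 + 2))
    (cupProduct (rfl : 2 * 1 + 2 * 2 = 2 * 1 + 2 * 2)
      (complexBetti.map (SemiCartesianMonoidalCategory.snd _ _) (2 * 1) y) γ)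

/-- `Quadratic[S]`: VERBATIM the `Quadratic[S]` binder of `…NLAscentQuadratic`. Local notation only. -/
local notation3 (prettyPrint := false) "Quadratic[" S "]" =>
  (∃ (t : complexBetti S (2 * 1) →ₗ[ℂ] complexBetti S (2 * 1)) (P : ℚ[X]),
    (∀ y, IsRationalClass y → IsRationalClass (t y)) ∧
    (∀ (i j : ℕ) (y : complexBetti S (2 * 1)),
      IsOfHodgeType 2 S (2 * 1) i j y → IsOfHodgeType 2 S (2 * 1) i j (t y)) ∧
    (∀ d ∈ algebraicClasses S 1, t d = 0) ∧
    (∀ (y : complexBetti S (2 * 1)), ∀ d ∈ algebraicClasses S 1,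
      cupProduct (rfl : 2 * 1 + 2 * 1 = 2 * 2) (t y) d = 0) ∧
    Irreducible P ∧ P.natDegree = 2 ∧ IsAnnihilatedOnTranscendentalBy S t P ∧
    TranscendentalEndomorphismsGeneratedBy S t)

/-- `NLAscentFamily₂[S, hS]`: VERBATIM the displayed QUADRATIC ascent family of `…NLAscentQuadratic`. Local notation only.
[cite: GeemenSchutt2023, §2.6, Prop. 3.2 and §6.6] [cite: VoisinHodgeII2003, §5.3.4 and §7.3.2] -/
local notation3 (prettyPrint := false) "NLAscentFamily₂[" S ", " hS "]" =>
  (∃ (t f : complexBetti S (2 * 1) →ₗ[ℂ] complexBetti S (2 * 1)),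
    (∀ y, IsRationalClass y → IsRationalClass (t y)) ∧
    (∀ d ∈ algebraicClasses S 1, t d = 0) ∧
    TranscendentalEndomorphismsGeneratedBy S t ∧
    (∀ y, f y ∈ algebraicClasses S 1) ∧
    (∀ y : complexBetti S (2 * 1),
      (∀ d ∈ algebraicClasses S 1, cupProduct (rfl : 2 * 1 + 2 * 1 = 2 * 2) y d = 0) → f y = 0) ∧
    ∃ (𝒳 B : SchemeOver ℂ) (g : 𝒳 ⟶ B),
      IsSmoothProjectiveFamily g 4 ∧ IsQuasiProjectiveOver 𝒳 ∧ IsQuasiProjectiveOver B ∧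
      AlgebraicGeometry.Smooth B.hom ∧ IrreducibleSpace B.left ∧
      ∃ (σ : ComplexPoints B → FiberClass g (2 * 2)) (hpt : ∀ b, (σ b).pt = b), Continuous σ ∧
      ∃ (b₁ : ComplexPoints B) (e₁ : S ⊗ S ≅ fiberOver g b₁),
        (∀ y : complexBetti S (2 * 1),
          t y + f y = Corr[complexOrientationFamily, hS ;
            complexBetti.map e₁.hom (2 * 2) ((σ b₁).clsAt (hpt b₁)), y]) ∧
        ∀ᶠ b in residual (ComplexPoints B),
          IsRationalClass ((σ b).clsAt (hpt b)) ∧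
          IsOfHodgeType 4 (fiberOver g b) (2 * 2) 2 2 ((σ b).clsAt (hpt b)) ∧
          ∃ (S' : SchemeOver ℂ) (_ : IsK3Surface S') (_ : fiberOver g b ≅ S' ⊗ S'),
            Quadratic[S'] ∧
            Module.finrank ℂ ↥(algebraicClasses S' 1) + 2 = Module.finrank ℂ ↥(algebraicClasses S 1))

variable {X S : SchemeOver ℂ} {φ : complexBetti X 2 ≃ₗ[ℂ] (K3HilbertIndex → ℂ)} {P : complexBetti X (2 * 4)}
  {z : K3HilbertIndex → ℂ} {η : complexBetti S (2 * 1) ≃ₗ[ℂ] (K3Index → ℂ)} {p : complexBetti S (2 * 2)}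
  {x : K3Index → ℂ}

/-- **«RANK-PARTNERED-HK», pointwise.** For a marked smooth projective `K3^{[2]}`-type fourfold `X` with
`ρ(X) ∈ {9, 13, 15, 17}` and a K3 partner `(S, η, p, x, g)` with (g1), (g2), (g5), (g6): `HodgeConjectureFor 4 X`, GRANTED the
seven displayed named facts, the displayed quadratic Noether–Lefschetz ascent families of `…NLAscentQuadratic` and HC⁴ for the
Picard-number-2 quadratic-RM K3 squares. Proof: `ρ(S) = ρ(X) − 1 ∈ {8, 12, 14, 16}` (the two inequalities
`finrank_algebraicClasses_le_partner_succ_of_partner`, `finrank_algebraicClasses_succ_le_of_partner_onto`), the K3-side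
`RealMultiplicationType.hodgeConjectureFor_square_of_rank_mem`, and `partnerTransport_explicit`.
[cite: Markman2024, Thm. 1.1 and 1.4] [cite: Beauville1983, §6 Prop. 6] [cite: GeemenSchutt2023, §2.6, Prop. 3.2 and §6.6]
[cite: Buskin2019, Thm. 1.1] -/
theorem hodgeConjectureFor_of_partner_of_rank_mem
    (hBI : Beauville1983_hilbertSquare_markedIncidence)
    (hBD : Beauville1983_hilbertSquare_blowupDiagonal_surjection)
    (hMk : Markman2024_rationalHodgeIsometry_lift_algebraic_marked)
    (hcup : Voisin2003_cupProduct_algebraicClasses)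
    (hB : Buskin2019_hodgeIsometry_algebraic) (hmark : Huybrechts_K3_marking_exists)
    (hAsc : ∀ (S : SchemeOver ℂ) (hS : IsK3Surface S), ¬ HasComplexMultiplication S → Quadratic[S] →
      4 ≤ Module.finrank ℂ ↥(algebraicClasses S 1) → NLAscentFamily₂[S, hS.isSmoothProjective])
    (hCell : ∀ (S : SchemeOver ℂ) (hS : IsK3Surface S), ¬ HasComplexMultiplication S → Quadratic[S] →
      Module.finrank ℂ ↥(algebraicClasses S 1) = 2 → HodgeConjectureFor 4 (S ⊗ S))
    (hX : IsSmoothProjective 4 X) (hK : IsOfK3HilbertSquareType X) (hM : MarkedK3Sq[X, φ, P, z])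
    (hρ : Module.finrank ℂ ↥(algebraicClasses X 1) = 9 ∨ Module.finrank ℂ ↥(algebraicClasses X 1) = 13 ∨
      Module.finrank ℂ ↥(algebraicClasses X 1) = 15 ∨ Module.finrank ℂ ↥(algebraicClasses X 1) = 17)
    (hS : IsK3Surface S) (hMS : MarkedK3[S, η, p, x])
    {g : complexBetti S (2 * 1) →ₗ[ℂ] complexBetti X 2} (hg : Partner[X, φ, S, η, g]) (hg6 : Onto[X, φ, S, g]) :
    HodgeConjectureFor 4 X := by
  obtain ⟨hp0, hmk, hxx, hxpos, hu⟩ := hMS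
  obtain ⟨hg1, hg2, hg5⟩ := hg
  have hμ := hasPoincareDuality_complexOrientationFamily
  obtain ⟨H, hH, Ξ, φH, PH, -, -, hMH, θ, hθ, hi⟩ := hBI complexOrientationFamily hμ S hS η p x hmk hxx hxpos hu
  obtain ⟨-, -, hηint, hcupS, h20, -⟩ := id hmk
  -- `ρ(S) = ρ(X) − 1 ∈ {8, 12, 14, 16}`
  have hle := finrank_algebraicClasses_le_partner_succ_of_partner hcup hμ hX hM hS hp0 hηint hcupS h20 hxpos hH
    hMH hθ hi hg1 hg2 hg5
  have hge := finrank_algebraicClasses_succ_le_of_partner_onto φ η hp0 hcupS g hg6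
  have hρS : Module.finrank ℂ ↥(algebraicClasses S 1) = 8 ∨ Module.finrank ℂ ↥(algebraicClasses S 1) = 12 ∨
      Module.finrank ℂ ↥(algebraicClasses S 1) = 14 ∨ Module.finrank ℂ ↥(algebraicClasses S 1) = 16 := by omega
  -- the K3-side theorem and partner transport
  have hHC : HodgeConjectureFor 4 (S ⊗ S) :=
    RealMultiplicationType.hodgeConjectureFor_square_of_rank_mem hB hmark hAsc hCell hS hρS
  exact partnerTransport_explicit hBI hBD hMk hcup hX hK hM hS hmk hxx hxpos hu hg1 hg2 hg5 hHC

/-- **«RANK-PARTNERED-HK»: the Hodge conjecture for EVERY marked smooth projective `K3^{[2]}`-type fourfold with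
`ρ(X) ∈ {9, 13, 15, 17}`**, GRANTED the eight displayed named facts (the seven of the pointwise form + period surjectivity for
the existence of the partner, `partnerExistence_explicit`), the displayed quadratic ascent families (moduli input (I1′)) and
HC⁴ for the Picard-number-2 quadratic-RM K3 squares (crux #5's cell `(3,2)` in K3 form). No hypothesis on `X` beyond its
Picard number: the partners have `ρ(S) ∈ {8, 12, 14, 16}`, where real QUADRATIC multiplication is forced.
[cite: Markman2024, Thm. 1.1 and 1.4] [cite: Huybrechts2016K3, Ch. 6 Thm. 3.1 and Ch. 7 Thm. 4.1]
[cite: GeemenSchutt2023, §2.6, Prop. 3.2 and §6.6] [cite: Buskin2019, Thm. 1.1] -/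
theorem hodgeConjectureFor_of_rank_mem_K3Sq2Type
    (hPS : Huybrechts_K3_periodSurjective_projective)
    (hBI : Beauville1983_hilbertSquare_markedIncidence)
    (hBD : Beauville1983_hilbertSquare_blowupDiagonal_surjection)
    (hMk : Markman2024_rationalHodgeIsometry_lift_algebraic_marked)
    (hcup : Voisin2003_cupProduct_algebraicClasses)
    (hB : Buskin2019_hodgeIsometry_algebraic) (hmark : Huybrechts_K3_marking_exists)
    (hAsc : ∀ (S : SchemeOver ℂ) (hS : IsK3Surface S), ¬ HasComplexMultiplication S → Quadratic[S] →
      4 ≤ Module.finrank ℂ ↥(algebraicClasses S 1) → NLAscentFamily₂[S, hS.isSmoothProjective])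
    (hCell : ∀ (S : SchemeOver ℂ) (hS : IsK3Surface S), ¬ HasComplexMultiplication S → Quadratic[S] →
      Module.finrank ℂ ↥(algebraicClasses S 1) = 2 → HodgeConjectureFor 4 (S ⊗ S))
    (hX : IsSmoothProjective 4 X) (hK : IsOfK3HilbertSquareType X) (hM : MarkedK3Sq[X, φ, P, z])
    (hρ : Module.finrank ℂ ↥(algebraicClasses X 1) = 9 ∨ Module.finrank ℂ ↥(algebraicClasses X 1) = 13 ∨
      Module.finrank ℂ ↥(algebraicClasses X 1) = 15 ∨ Module.finrank ℂ ↥(algebraicClasses X 1) = 17) :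
    HodgeConjectureFor 4 X := by
  obtain ⟨S, η, p, x, g, hS, hMS, hg, -⟩ := partnerExistence_explicit hPS hX hM (by omega)
  exact hodgeConjectureFor_of_partner_of_rank_mem hBI hBD hMk hcup hB hmark hAsc hCell hX hK hM hρ hS hMS
    ⟨hg.1, hg.2.1, hg.2.2.2.2.1⟩ hg.2.2.2.2.2.1

end Summit.HodgeConjecture.HodgeConjecture.Theorems.MarkmanPartnerTransport.PartnerLattice

end
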